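import Mathlib
import HarnessLib
import HarnessLib.Audit
import Summits.ABC.ABC.Statement
import Literature.NumberTheory.EllipticCurves.PAdicHeights

/-!
Route: DilogDepthLaw

CLOSED (exhausted) 2026-08-15T16:22:55Z by planner-rrepair-ABC-DilogDepthLaw-88329fcf-g2-0 — reason: exhausted — note: exhausted (planner route-repair g2, 2026-08-15; census = CENSUS-DilogDepthLaw.md on stmt-ABC-3741). TRIED: (1) the filed thesis X = DilogBilinearity ∧ BilinearDepthBound (+ rung ThreePrimeDepthBound): both depth cruxes are heuristically FALSE for every ε < 1/3 — identity B_p(a,b,c) = −D_p(c/a) + L_p. The file is kept as the record of this route; refuted decls are indexed as negative knowledge (`ledger negatives`).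

# Route DilogDepthLaw — abc as a depth bound for one antisymmetric bilinear form of p-adic
dilogarithm periods on the c-support

Route for idea card ABC/ABC/dilog-depth-law-bilinear-periods-v2 (Dilogarithmic depth law, v2). Write
D_p(x) := Σ_{n≥1} xⁿ/n² + ½·log_p(x)·log_p(1−x) ∈ ℚ_p
(Coleman's p-adic Bloch–Wigner function, Iwasawa branch
`Literature.NumberTheory.EllipticCurves.padicLog`, written as the convergent series valid for v_p(x)
≥ 1).
Call an antisymmetric array ℓ_p : primes × primes → ℚ_p ADMISSIBLE at p if D_p(x) = Σ_{q,q'}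
v_q(x)·v_{q'}(1−x)·ℓ_p(q,q') for every rational x with v_p(x) ≥ 1
(the INTERFACE; no existence smuggled in). For pairwise coprime positive (a,b,c) and p | c put
B_p(a,b,c) := Σ_{q,q'} (v_q a − v_q c)(v_{q'} b − v_{q'} c)·ℓ_p(q,q') and the
dilogarithmic depth divisor depth(a,b,c) := Π_{p|c} p^min(v_p(c), v_p(B_p)) (a divisor of c). THESIS
X = X1 ∧ X2 ("it suffices to show"):
X1 = DilogBilinearity (CONSTRUCTION, the Coleman–Suslin fact, first crux): for every prime p an
admissible ℓ_p exists — including the BAD primes p | abc;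
X2 = BilinearDepthBound (BDB): for every admissible system ℓ and every ε > 0 there is C with
depth(a,b,c) ≤ C^(ω(abc)+1)·rad(abc)^(1+ε)·max(a,b,c)^ε
for ALL pairwise coprime positive (a,b,c) — no equation a + b = c anywhere. X → ABC because for an
abc TRIPLE the depth law (support DepthLaw:
v_p(D_p(x)) = v_p(x) for p odd, and for p = 2 when v_2(x) ≥ 3) and admissibility at x = c/a give
v_p(B_p(a,b,c)) = v_p(D_p(c/a)) = v_p(c), so depth(a,b,c) ≥ c/4,
whence c^(1−ε) ≤ 4·C^(ω+1)·rad^(1+ε) and C^(ω(abc)) = rad(abc)^o(1).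
Lean: `DilogBilinearity ∧ BilinearDepthBound` (= item Target; both conjuncts are decls of this route
file with the bodies given under Cruxes; Sketch.lean rc 0 with `import
Literature.NumberTheory.EllipticCurves.PAdicHeights`)

## Assembly
Pure bookkeeping once DepthLaw is in hand: choose ℓ_p for every p from DilogBilinearity
(Classical.choice under the `[Fact p.Prime]` binder); BilinearDepthBound with ε' gives C; for an abc
triple (a,b,c) and p | c, admissibility at x = c/a (v_p(x) = v_p(c) ≥ 1; num x·den x·num(1−x) =
c·a·b) identifies Σ (v_q c − v_q a)(v_(q') b − v_(q') a) ℓ_p(q,q') = D_p(c/a), and antisymmetry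
turns this into −B_p(a,b,c); DepthLaw gives valuation v_p(c) for p odd and for p = 2 with v_2(c) ≥
3, so the depth divisor is ≥ c/4; hence c^(1−ε') ≤ 4·C^(ω(abc)+1)·rad(abc)^(1+ε'); finally C^(ω(n))
≤ C_δ·n^δ for squarefree n = rad(abc) (tree lemma pow_card_primeFactors_le + divisor bound, as in
Literature.Barriers.Parity.SiegelZeroDichotomyChowlaLemma37) and ε', δ small in terms of ε give c <
C''·rad(abc)^(1+ε), i.e. `ABC` (= Literature.Abc.ABCConjecture, ABC_iff).

Rationale: WHY THIS LINE. MECHANISM (functorial invariant + one new object): by Suslin's exact sequence 0 →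
B(F) → P(F) → Λ²F^× → K₂(F) → 0 (Suslin1991 Thm 5.2) with K₃(ℚ) torsion (LeeSzczarba1976) and K₂(ℚ)
torsion (Tate, Milnor1972 §11), δ⊗ℚ : P(ℚ)⊗ℚ ≅ Λ²(ℚ^×)⊗ℚ; Coleman's D_p kills the 2- and 5-term
relations on all of ℂ_p∖{0,1} (Coleman1982 §VI, Prop 6.4; BesserDejeu2003 p.4 identifies this D), so
D_p = L_p∘δ for ONE ℚ-linear functional L_p on Λ²(ℚ^×)⊗ℚ at EVERY prime p, and ℓ_p(q,q') :=
L_p(q∧q') are universal p-adic weight-2 periods. Dan-Cohen–Wewers prove exactly this bilinearity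
(h_13(x,y) = Σ h^(q_i,q_j) x_i y_j, h_13(t,1−t) = −Li(t), twisted antisymmetry; DancohenWewers2014
Thms (111212a/c), (111227c/d), read pp. 6, 19–20) but always at a GOOD prime p > max S, to locate
zeros of Kim's functions; read instead at the BAD primes p | abc, D_p does not vanish but MEASURES
DEPTH: v_p(D_p(c/a)) = v_p(c) (three lines of p-adic analysis, support DepthLaw), i.e. log c =
Σ_{p|c} v_p(eᵀM_p f)·log p exactly, with M_p = (ℓ_p(q,q')) one antisymmetric matrix and e, f the
exponent vectors of a/c, b/c. abc becomes: the integer rank-2 matrix e∧f cannot be p-adically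
orthogonal to the universal period vectors at many primes of c at once unless rad(abc) is large — a
simultaneous p-adic Diophantine-approximation statement for depth-2 periods (Philippon1999's
several-places shape, one weight up), with the additive equation a + b = c ELIMINATED (BDB
quantifies over all pairwise coprime (a,b,c)). Imported areas: K-theory of fields / Bloch groups
(Suslin), Coleman integration (p-adic polylogarithms), Chabauty–Kim in depth 2 (DCW) — brought to
abc at the bad primes; nothing of this is in the 2 open ABC routes (BelyiSqueeze, NegOmegaAtlas) or
the negatives index (empty).

RANKED CRUXES. #0 Target (target) — X = DilogBilinearity ∧ BilinearDepthBound (construction of the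
period system + the bilinear depth bound). (why it might fail: BDB is abc-hard (it implies ABC
outright and heuristically equals [generic p-adic behaviour of the periods] ∧ [ABC]); no
transcendence method for depth-2 p-adic periods exists yet.) [DancohenWewers2014, Coleman1982,
Suslin1991, Philippon1999]
#2 DilogBilinearity (crux) — CONSTRUCTION / named fact (first crux on purpose: the route's object).
For every prime p there is an antisymmetric ℓ_p : ℕ → ℕ → ℚ_p with D_p(x) = Σ_{q,q' ∈
primeFactors(num x · den x · num(1−x))} v_q(x)·v_{q'}(1−x)·ℓ_p(q,q') for every rational x ≠ 0 with
v_p(x) ≥ 1, where D_p(x) = Σ_{n≥1} xⁿ/n² + ½ log_p x · log_p(1−x) (Iwasawa log_p = Literature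
padicLog). Paper proof: Coleman1982 §VI (D = Li₂ + ½ log·log(1−·) satisfies inversion Prop 6.4,
reflection, and the 5-term relation on ℂ_p∖{0,1}; BesserDejeu2003 p.4) ⇒ D_p is additive on the
pre-Bloch group P(ℚ); Suslin1991 Thm 5.2 + LeeSzczarba1976 (K₃(ℤ)=ℤ/48 ⇒ B(ℚ)⊗ℚ = 0) + Tate (K₂(ℚ)
torsion, Milnor1972 §11) ⇒ δ⊗ℚ is an isomorphism ⇒ L_p := D_p∘(δ⊗ℚ)⁻¹, ℓ_p(q,q') := L_p(q∧q'); at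
p-small x the series IS Coleman's D_p. Card items S1. Expected to enter Literature as a cited fact
(cite item filed) and then be discharged as `(h : Fact) → DilogBilinearity`; a Lean proof from
scratch needs Coleman integration (far). [difficulty: L] (why it might fail: Coleman's 5-term
relation must hold for his D with ONE fixed branch across all residue discs incl. |x|_p ≠ 1 (we use
x with p | num x); if Col82 §VI proves it only on units / up to a constant, additivity on P(ℚ) at p
∈ S breaks — exactly the bad-prime extension DCW avoid (they take p > max S).) [Coleman1982,
BesserDejeu2003, Suslin1991, LeeSzczarba1976, Milnor1972, DancohenWewers2014, arXiv:1209.0276]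
#3 ThreePrimeDepthBound (crux) — BDB for three primes (card S2, the first open rung): for every
system ℓ admissible at all primes and every ε > 0 there is C > 0 such that for all pairwise distinct
primes q₁, q₂, q₃ and all x, y, z ≥ 1: q₃^min(z, v_(q₃)(xy·ℓ_(q₃)(q₁,q₂) − xz·ℓ_(q₃)(q₁,q₃) +
yz·ℓ_(q₃)(q₂,q₃))) ≤ C·(q₁q₂q₃)^(1+ε)·max(q₁^x, q₂^y, q₃^z)^ε. (xy, −xz, yz) = e∧f is the cross
product of the exponent vectors; for TRIPLE data q₁^x + q₂^y = q₃^z the valuation is exactly z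
(DepthLaw), so the statement contains abc for three prime powers (support ThreePrimePowers) and
reads: (1/x, 1/y, 1/z) is not a simultaneous near-zero of the fixed period form beyond the trivial
exponent. Heuristic for non-triple data: a violation needs v ≥ 2 at a prime q₃ with q₁q₂ <
q₃^(1−ε'), expected count Σ_q q^(−1−ε') < ∞ (typical valuation of the form is 0: D_p at special
units ≡ Teichmüller values ≡ p-adic L-values, generically units) — absorbed by C. [deps:
DilogBilinearity] [difficulty: open-problem] (why it might fail: if the periods ℓ_p(q,q') are
abnormally well approximable (or ℚ-dependent: even ℓ_p(2,3) ∉ ℚ is open) the 'random valuation'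
heuristic is void; and if SymbolSpan fails at some p a non-canonical admissible ℓ could break the ∀ℓ
form trivially.) [DancohenWewers2014, Philippon1999, BakerWustholz2007, Coleman1982]
#4 BilinearDepthBound (crux) — BDB(ε), general support (card S3, corrected): for every admissible
system ℓ and every ε > 0 there is C > 0 such that for all pairwise coprime positive a, b, c: Π_(p|c)
p^min(v_p(c), v_p(B_p(a,b,c))) ≤ C^(ω(abc)+1)·rad(abc)^(1+ε)·max(a,b,c)^ε, with B_p(a,b,c) = Σ_(q,q'
| abc) (v_q a − v_q c)(v_(q') b − v_(q') c)·ℓ_p(q,q') ∈ ℚ_p (Lean: valuation of 0 is 0, and the min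
caps accidental over-depth, so only 'as deep as c itself' counts). Restricted to a + b = c it is
EQUIVALENT to ABC given DilogBilinearity + DepthLaw; for general data it is the statement that one
integer antisymmetric rank-2 matrix e∧f is not p-adically orthogonal to the universal period
matrices M_p at the primes of c beyond what rad(abc)^(1+ε)·height^ε pays for. Corrections w.r.t. the
card: depth on the c-support only (v1's total excess is false on (1, 9ⁿ−1, 9ⁿ)); the size term
max(a,b,c)^ε is NECESSARY (data (2^T, 3^U, 5): depth ≍ 2 log T unbounded at fixed radical); constant
C^(ω+1) = the card's C_ε·|S| in multiplicative form, absorbed in the assembly by 2^ω(n) ≤ d(n) ≪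
n^δ. [deps: DilogBilinearity] [difficulty: open-problem] (why it might fail: implies ABC; for
non-triple data only heuristic — families a+b = mc, permuted triples, powers were checked by hand,
but e∧f tracking a rational relation among the ℓ_p(q,q') would give systematic depth; and the Baker
wall: no lower bound of any shape for |B_p|_p is known.) [DancohenWewers2014, Philippon1999,
BakerWustholz2007, StewartYu2001, EvertseGyory2015]
#9 DepthLaw (support) — the depth law (card S1; provable now, elementary ultrametric estimates): for
p prime and rational x ≠ 0 with v = v_p(x) ≥ 1, and (p ≠ 2 or v ≥ 3): the valuation of D_p(x) = Σ
xⁿ/n² + ½ log_p x log_p(1−x) is exactly v. Proof sketch: the n = 1 term is x; for n ≥ 2, n·v −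
2v_p(n) ≥ v+1 except (p,v,n) = (3,1,3) where x + x³/9 = x(1 + (x/3)²) and (x/3)² ≡ 1 (mod 3) since
−1 is a non-residue, so the valuation is still v; log_p of the unit part has valuation ≥ 1 (≥ 2 at p
= 2) and log_p(1−x) = −Σ xⁿ/n has valuation v (p odd; v for p = 2, v ≥ 2), so the log term has
valuation ≥ v+1. At p = 2, v ∈ {1,2} only ≥ holds (not claimed). Uses the PROVED tree facts
hasSum_padicLog_holds, padicLog_mul_holds, padicLog_natCast_self_holds. [difficulty: provable-now]
[Coleman1982, Iwasawa1972PadicL]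
#9 SymbolSpan (support) — uniqueness of admissible systems (makes '∀ admissible ℓ' in the two BDB
cruxes mean 'Coleman's canonical ℓ'): for every prime p and primes q ≠ q', the elementary
antisymmetric matrix E_(qq') − E_(q'q) is a ℚ-combination of the symbols σ(a,b,c) = (v(a)−v(c)) ∧
(v(b)−v(c)) of abc triples with p | abc. (p-small rationals x are exactly members-ratios of triples
with p dividing a member; their symbols are ±σ.) Equivalently: the p-divisible part of P(ℚ)⊗ℚ is
everything. Expected true with enormous over-determination (for S = primes ≤ X the number of
X-smooth triples is super-exponential in π(X) while dim Λ² = π(X)²/2); finite exact check per (S, p)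
by rank (kit/calib.gp prints it for S = {2,3,5}, p = 3, 5); a proof wants a p-adapted variant of
Tate's largest-prime descent (Milnor1972 §11; DancohenWewers2014 §11 is the p-free version).
[difficulty: M] [Milnor1972, DancohenWewers2014, Suslin1991]
#9 ThreePrimePowers (support) — milestone glue (card 'rank-0 milestone'): DilogBilinearity →
ThreePrimeDepthBound → abc for triples of three prime powers (a, b, c all prime powers): ∀ ε > 0 ∃ C
> 0, c < C·rad(abc)^(1+ε). Proof: instantiate ℓ from DilogBilinearity (choice over p), apply the
three-prime bound at (q₁,q₂,q₃; x,y,z) read off a = q₁^x, b = q₂^y, c = q₃^z, and use DepthLaw at x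
= c/a (q₃ odd, or q₃ = 2 with z ≥ 3; z ≤ 2 at q₃ = 2 is c ≤ 4) to get min(z, v) = z. [difficulty:
provable-now] [DancohenWewers2014, Coleman1982]

TWO-LAYER PLAN. Foreseen glued splits, none filed now (D-0019): BilinearDepthBound ⇐ [BDB for ω(abc)
≤ k, constants uniform in the primes] → [a transfer/induction in |S| using DCW's compatibility of
h_13 under enlarging S] → BilinearDepthBound; ThreePrimeDepthBound ⇐ [a Khintchine/transference
statement for the single point (ℓ(q₁,q₂):ℓ(q₁,q₃):ℓ(q₂,q₃)) ∈ ℙ²(ℚ_(q₃)) against the rational points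
(xy:−xz:yz)] → [uniformity of its constant in q₁q₂q₃ ('bilinear p-adic Baker')] →
ThreePrimeDepthBound; DilogBilinearity ⇐ [Coleman 5-term relation as a Literature fact] → [Suslin⊗ℚ
for ℚ as a Literature fact] → DilogBilinearity.

KILL CRITERIA. (1) DilogBilinearity REFUTED (numerically: the over-determined calibration system for
(ℓ_5(q,q'))_(q,q'∈{2,3,5}) from the {2,3,5}-unit equation solutions divisible by 5 is inconsistent
to 5-adic precision, or Coleman's 5-term relation is shown to fail across residue discs) ⇒ close the
route refuted:DilogBilinearity — the object does not exist at bad primes and nothing survives but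
DepthLaw. (2) ThreePrimeDepthBound or BilinearDepthBound REFUTED by an explicit non-triple family
with systematic depth (e.g. depth ≥ κ·height along infinitely many (x,y,z), or v ≥ 2 at a positive
proportion of large q₃) for the canonical ℓ with SymbolSpan verified for that S ⇒ restate once with
the family's mechanism excluded if it is a rational period relation (that relation is itself a
publishable period identity), else close refuted. (3) A proof that any lower bound for |B_p(e,f)|_p
formally reduces to Yu's bound for a weight-1 linear form with the same constants ('weight 2 is a
costume of weight 1') ⇒ close superseded/known: the route then sits exactly on
Literature.Barriers.ABC.BakerMethodBounds. (4) SymbolSpan refuted at some p ⇒ pivot: restate both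
BDB cruxes for the canonical ℓ via the ColemanDilogarithm definition (definition request) instead of
'∀ admissible'.

NOT DECOMPOSED YET. Deliberately NOT filed at open: the odd-weight tower (card S4: weight-n Coleman
polylog laws with the L_p(n,ω^(1−n)) term and the Kummer–Mirimanoff reduction at the exponent prime)
— not needed for ABC; the coproduct/'motivic conjugates of a small period are small' bootstrap (card
S2's hoped mechanism) — no statable form yet; the glue BilinearDepthBound → ThreePrimeDepthBound
(bookkeeping on factorizations of prime powers); the ω-absorption lemma and the B_p(a,b,c) =
−D_p(c/a) identity (lemmas riding with --supports Assembly); p = 2, v_2(c) ≤ 2 refinements of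
DepthLaw; any split of the two BDB cruxes by regime (bounded ω / balanced / one huge prime) until
one of them moves.

CHEAPEST FALSIFIER. The calibration at a BAD prime (card S5(ii), the audit's request): every
{2,3,5}-smooth abc triple with 5 | abc gives, through its 5-small member ratios x, a linear equation
D_5(x) = Σ m_(qq')(x) ℓ_5(q,q') in the three unknowns ℓ_5(2,3), ℓ_5(2,5), ℓ_5(3,5), with D_5(x) an
explicit convergent 5-adic series — ≥ 20 equations for 3 unknowns. Inconsistency beyond precision
kills DilogBilinearity (and the route); consistency + rank 3 also certifies SymbolSpan for ({2,3,5},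
5) and hands the canonical constants to the ThreePrimeDepthBound scan of (2^x, 3^y, 5^z), x,y,z ≤
150 (min(z, v_5) histogram, smallest-height deep points; the abc triples 2+3=5 and 16+9=25 must show
v = z exactly). Script written and checked by hand: planner folder kit/calib.gp (PARI/GP, p = 3 and
5, ~2 min single core); NOT run at filing — the compute daemon socket was absent (kit: 'computed
socket absent'); first refuter/grounder with kit should run it verbatim (kit pari kit/calib.gp).

NUMBERS. Known solutions of 2^x + 3^y = 5^z: (1,1,1), (4,2,2) (scan must reproduce v_5 = z there).
K₃(ℤ) = ℤ/48 (LeeSzczarba1976); K₂(ℚ) = ℤ/2 ⊕ ⨁_(p odd) 𝔽_p^× (Tate, Milnor1972 Thm 11.6). DepthLaw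
exceptional cases: p = 2 with v_2 ∈ {1,2} (valuation ≥ 2, ≥ 3 resp., equality not claimed; costs the
factor 4 in the assembly); p = 3, v = 1 holds because −1 is a non-residue mod 3. Baker-side state of
the art the cruxes are measured against: log c ≤ κ·R^(1/3)(log R)³ (StewartYu2001) — exponential in
R; BDB asks polynomial.

DEFINITION REQUESTS. (1) notion ColemanPolylogarithm (topic
Literature/NumberTheory/PAdicPolylogarithms): Coleman's Li_n^(p) on ℂ_p∖{1} for the Iwasawa branch,
D_p := Li₂ + ½ log·log(1−·), with the named facts: inversion (Coleman1982 Prop 6.4), reflection,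
5-term relation (§VI), Li_n(1) ↔ Kubota–Leopoldt values — lets DilogBilinearity be stated for ALL x
(not only p-small) and the BDB cruxes for the canonical ℓ; (2) cite fact 'ColemanSuslinBilinearity'
= DilogBilinearity verbatim with cites Coleman1982 §VI, Suslin1991 Thm 5.2, LeeSzczarba1976,
Milnor1972 §11 (filed as a cite work item after open).

DEGENERATE CASES CHECKED. (i) TRIAGE-18 (card retired 2026-08-15 while this route was being filed,
reason 'BDB(ε) false by bilinearity'): the scaling family (a,b,c) = (1, 24^k, 25^k), k = 5^m, has
e∧f = k²·(e∧f of (1,24,25)), so v₅(B₅) = 2 + 2m while the CARD's right side stayed fixed — a correct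
kill of the card's literal BDB (no size term, no cap), and likewise (x,y,z) ↦ q₃^m·(x,y,z) kills the
card's S2. The ROUTE's statements were written with exactly this in view (see #4 'Corrections w.r.t.
the card'): BilinearDepthBound and ThreePrimeDepthBound carry the factor max(a,b,c)^ε (resp.
max(q₁^x,q₂^y,q₃^z)^ε) and the cap min(v_p(c), ·); on the family: LHS = 5^(2+2m) against RHS ≥
C⁴·30^(1+ε)·5^(2ε·5^m) — true for every m once C = C(ε) absorbs sup_m(2+2m − 2ε·5^m) < ∞; same for
the three-prime scaling (v+2m against ε·z·q₃^m). (ii) Triage's second point, 'a generic repair needs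
+2|S|·log T on the right and then triples only give log c ≤ (3+ε) log rad': the route's size term is
ε·log(height), which costs a triple only c^ε (full ABC survives in the Assembly), and it still
dominates the generic depth of NON-triple data because the radical of s distinct primes is ≥ s! :
generic capped depth over the (3T)^s data of support S and exponents ≤ T is s·log T·(1+o(1))
(Chernoff with θ = 1 − 1/log T; the factor 2 of the crude union bound is spurious), and s log T = s
log s + s log(T/s) ≤ (log rad(S) + O(s)) + (ε·T·log 2 + C_ε·s) — i.e. inside (1+ε)·log rad +
ε·height + C_ε·(ω+1) with the margin ε·s·log s; this is the same knife-edge on which abc itself is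
heuristically true, not a new loss. (iii) v1-killer (1, 9ⁿ−1, 9ⁿ) and the Stewart–Tijdeman/B–G
pigeonhole families: triple data, depth = c/O(1), BDB there is ABC with C^(ω) = rad^o(1) —
consistent. (iv) Structured non-triple data: a + b = m·c gives B_p(a,b,c) = B_p(triple a+b=mc) +
L_p((a/b)∧m), generically a unit, so NO systematic depth; permuted triples (b + c = a) give full
depth of c and BDB asks log c ≤ (1+ε) log rad(abc) + ε log a + …, weaker than abc for that triple;
exact zeros of B_p count 0 (Mathlib valuation convention) and are capped anyway. (v) p = 2, v₂(c) ≤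
2 and p = 3, v = 1: handled in DepthLaw/Assembly (factor 4; −1 non-residue mod 3).

Novelty: Searches (2026-08-15, this planner + the card + audit refuter-novelty-audit-14): lit search --hybrid
'Coleman p-adic dilogarithm functional equation Bloch Wigner five term' (local: noise only);
crossref 'Coleman Dilogarithms regulators' (→ Coleman1982 doi:10.1007/bf01399500), 'p-adic
dilogarithm abc conjecture radical' (0 relevant /5); zbMATH 'p-adic dilogarithm abc conjecture' 0,
'Bloch group abc conjecture' 0, 'Chabauty-Kim abc conjecture' 0, 'Coleman dilogarithm valuation
S-unit' 0, 'p-adic polylogarithm unit equation bad primes valuation' 0; lit galaxy search 'p-adic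
dilogarithm' --star all: 2 rows (Urbanowicz–Williams congruences book; one unrelated pdf);
arXiv/OpenAlex legs 429 (documented); lit frontier ABC --since 2020 and lit bridges ABC --cross any:
no polylog/Chabauty–Kim item among 30+30 rows; READ: DancohenWewers2014 = arXiv:1209.0276 pp. 4, 6,
19–20 (Thm (111212c) h_13 bilinear; (111227c) h_13(t,1−t) = −Li(t); (111227d) twisted antisymmetry;
coefficient formula (111212a) via Tate's K₂(ℚ) algorithm §11; hypothesis p > max S); BesserDejeu2003
= arXiv:math/0110334 pp. 4–5 (D = Li₂ + ½ log·Li₁-form is Coleman's D; Prop 6.4 of Col82; regulator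
on the Bloch group).
Nearest prior art found: DancohenWewers2014 (bilinearity of the depth-2 coordinate and its value
−Li(t) on points, at a good prime, used to cut out S-integral points); DancohenWewers2015
(arXiv:1311.7008, mixed Tate motives and the unit equation, same regime); Coleman1982 (the functions
and their functional  [refs: 10.1007/bf01399500, 1209.0276, math/0110334, 1311.7008, doi:10.1007/bf01399500, Coleman1982, DancohenWewers2014, BesserDejeu2003, DancohenWewers2015, Philippon1999]

Barriers (technique_class: p-adic-transcendence, depth-two-periods, bilinear-baker): - technique_class: p-adic-transcendence, depth-two-periods, bilinear-baker
- Literature.Barriers.ABC.BakerMethodBounds: squarely engaged and NOT evaded by a theorem: both BDB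
cruxes are p-adic lower bounds (|B_p(e,f)|_p not too small at the primes of c) of exactly the
several-places shape of Philippon's 'conjecture optimiste' (evasions_known (a) of the barrier) but
one weight up; the bet is that depth-2 periods carry structure logs lack (antisymmetry, the
coproduct Δ'(antisymmetric word) = log⊗log, compatibility in S, finite calibration), so that 'deep'
becomes 'e∧f orthogonal to a universal period vector' rather than a product-of-heights loss; honest
status: no lower bound of any shape for depth-2 p-adic periods is known, and kill criterion (3)
names the collapse back onto the barrier.
- Literature.Barriers.ABC.EpsilonCannotBeDropped: respected — BDB keeps rad^(1+ε) AND a height^ε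
term and a constant C^(ω+1); the Stewart–Tijdeman/pigeonhole families (ω → ∞, quality → 1) satisfy
BDB's triple restriction with room; no ε-free or polylog-loss statement is aimed at.
- Literature.Barriers.ABC.IntegersHaveNoDerivation: not in the class — L_p is a ℚ-linear functional
on Λ²(ℚ^×)⊗ℚ ≅ P(ℚ)⊗ℚ coming from K-theory, not a Leibniz map on ℤ; no Mason–Stothers/Wronskian
transfer is attempted (file NoArithmeticDerivative.lean).
- Literature.Barriers.ABC.MasonStothersFailsInCharP: not engaged (no function-field transfer).
- Literature.Barriers.ABC.IUTDisputedClaim: not used.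
- Negatives index:

Novelty grade: new-combination — ROUTE REVIEW (refuter, route-review mode) 2026-08-15 — verdict: NO OBJECTION, route stays open. 8/8 decls elaborate (W2.lean rc0; Target/Assembly definitional; ABC = Literature.Abc.ABCConjecture). Cheapest falsifier RUN here for the first time, PASSED: p-adic calibration of admissible ℓ_p at p∈{2,3, (refuter refuter-rreview-route-KontsevichZagierPe-a9349b05-0, 2026-08-15T14:05:58Z; prior: DancohenWewers2014 (arXiv:1209.0276), DancohenWewers2015 (arXiv:1311.7008), Coleman1982 (doi:10.1007/bf01399500), BesserDejeu2003, Suslin1991, Philippon1999)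

History (route lifecycle, newest last):
- 2026-08-15T11:23:29Z · rev 1: restated Target (stmt-ABC-3602) — rev 1: inline Target (was rendered BLOCKED: target precedes crux decls); rationale gains DEGENERATE CASES CHECKED answering triage-18's retirement of the card ( (planner-plancard-ABC-ABC-dilog-depth-law-bili-6d81038a-0)
- 2026-08-15T16:22:55Z · CLOSED exhausted — exhausted (planner-rrepair-ABC-DilogDepthLaw-88329fcf-g2-0)

sub-problem: ABC · status: closed(exhausted) · opened planner-plancard-ABC-ABC-dilog-depth-law-bili-6d81038a-0 2026-08-15T11:21:00Z · rev 3 · ledger route-ABC-DilogDepthLaw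
GENERATED by the gate from the ledger (D-0016/17). Provers cite these decls: `theorem foo : Summit.ABC.ABC.Theses.DilogDepthLaw.<Decl> := …` in Summits/ABC/ABC/Theorems/<Name>.lean.
-/

namespace Summit.ABC.ABC.Theses.DilogDepthLaw

open scoped BigOperators Topology Manifold Classical MeasureTheory ProbabilityTheory Matrix InnerProductSpace ComplexConjugate ContinuousMap
open Filter Set Function TopologicalSpace MeasureTheory

attribute [summit_statement] _root_.ABC

open Literature.Abc

-- earlier Target (stmt-ABC-3602, replaced 2026-08-15T11:23:29Z -> stmt-ABC-3741): retired by None — DilogBilinearity ∧ BilinearDepthBound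
/-- item stmt-ABC-3741 · target · rank 0 · closed · moot by None · by planner
why it might fail: X ⇔ BilinearDepthBound (1st conjunct is known: Coleman–Wojtkowiak–Suslin), which implies ABC and, off the triple locus, forbids Wieferich-type coincidences i·F₂(P)≡j·F₃(P) mod P (i,j≤2log P) at all large P — 220 primes ≤2·10⁵ have one; heuristically X is false as stated.
sources: DancohenWewers2014, Coleman1982, Suslin1991, Philippon1999, Silverman1988, CrandallDilcherPomerance1997
[target] X = DilogBilinearity ∧ BilinearDepthBound, conjunction INLINED (the gate renders the target
before the crux decls, so the short form did not resolve); definitionally equal to the two crux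
decls (Sketch.lean: Iff.rfl). -/
@[route_item "route-ABC-DilogDepthLaw"]
def Target : Prop :=
  (∀ (p : ℕ) [Fact p.Prime], ∃ ℓ : ℕ → ℕ → ℚ_[p], (∀ q q' : ℕ, ℓ q q' = -ℓ q' q) ∧ ∀ x : ℚ, x ≠ 0 → 1 ≤ padicValRat p x → (∑' n : ℕ, ((x : ℚ_[p]) ^ (n + 1)) / (((n : ℚ_[p]) + 1) ^ 2)) + (1 / 2 : ℚ_[p]) * Literature.NumberTheory.EllipticCurves.padicLog p (x : ℚ_[p]) * Literature.NumberTheory.EllipticCurves.padicLog p (1 - (x : ℚ_[p])) = ∑ q ∈ (x.num.natAbs * x.den * (1 - x).num.natAbs).primeFactors, ∑ q' ∈ (x.num.natAbs * x.den * (1 - x).num.natAbs).primeFactors, ((padicValRat q x : ℤ) : ℚ_[p]) * ((padicValRat q' (1 - x) : ℤ) : ℚ_[p]) * ℓ q q') ∧ (∀ ℓ : ((p : ℕ) → [Fact p.Prime] → ℕ → ℕ → ℚ_[p]), (∀ (p : ℕ) [Fact p.Prime], (∀ q q' : ℕ, ℓ p q q' = -ℓ p q' q) ∧ ∀ x : ℚ,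 x ≠ 0 → 1 ≤ padicValRat p x → (∑' n : ℕ, ((x : ℚ_[p]) ^ (n + 1)) / (((n : ℚ_[p]) + 1) ^ 2)) + (1 / 2 : ℚ_[p]) * Literature.NumberTheory.EllipticCurves.padicLog p (x : ℚ_[p]) * Literature.NumberTheory.EllipticCurves.padicLog p (1 - (x : ℚ_[p])) = ∑ q ∈ (x.num.natAbs * x.den * (1 - x).num.natAbs).primeFactors, ∑ q' ∈ (x.num.natAbs * x.den * (1 - x).num.natAbs).primeFactors, ((padicValRat q x : ℤ) : ℚ_[p]) * ((padicValRat q' (1 - x) : ℤ) : ℚ_[p]) * ℓ p q q') → ∀ ε : ℝ, 0 < ε → ∃ C : ℝ, 0 < C ∧ ∀ a b c : ℕ, 0 < a → 0 < b → 0 < c → Nat.Coprime a b → Nat.Coprime b c → Nat.Coprime a c → (((∏ p ∈ c.primeFactors, (if hp : p.Prime then (haveI : Fact p.Prime := ⟨hp⟩; p ^ min (c.factorization p) (Padic.valuation (∑ q ∈ (a * b * c).primeFactors, ∑ q' ∈ (a * b * c).primeFactors, (((a.factorization q : ℤ) - (c.factorization q : ℤ) : ℤ) : ℚ_[p]) *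 (((b.factorization q' : ℤ) - (c.factorization q' : ℤ) : ℤ) : ℚ_[p]) * ℓ p q q')).toNat) else 1)) : ℕ) : ℝ) ≤ C ^ ((a * b * c).primeFactors.card + 1) * ((Literature.NumberTheory.DiophantineGeometry.rad a b c : ℕ) : ℝ) ^ (1 + ε) * ((max a (max b c) : ℕ) : ℝ) ^ ε)

/-- item stmt-ABC-3604 · crux · rank 3 · closed · moot by None · by planner
why it might fail: Suspect false: at (2,3,P; i,j,2) the form ≡ 2·log_P(3^j/2^i) mod P² (L_P ≡ log∘tame mod P², checked P≤71), so LHS=P² whenever i·F₂(P)≡j·F₃(P) mod P, i,j≤2log P: 220 primes ≤2·10⁵ (∼(log X)² growth), each forcing C ≥ P^(1−3ε)/6^(1+ε).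
sources: Silverman1988, CrandallDilcherPomerance1997, DancohenWewers2014, Philippon1999, StewartYu2001, Coleman1982
[crux] BDB for three primes (card S2, the first open rung): for every system ℓ admissible at all
primes and every ε > 0 there is C > 0 such that for all pairwise distinct primes q₁, q₂, q₃ and all
x, y, z ≥ 1: q₃^min(z, v_(q₃)(xy·ℓ_(q₃)(q₁,q₂) − xz·ℓ_(q₃)(q₁,q₃) + yz·ℓ_(q₃)(q₂,q₃))) ≤
C·(q₁q₂q₃)^(1+ε)·max(q₁^x, q₂^y, q₃^z)^ε. (xy, −xz, yz) = e∧f is the cross product of the exponent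
vectors; for TRIPLE data q₁^x + q₂^y = q₃^z the valuation is exactly z (DepthLaw), so the statement
contains abc for three prime powers (support ThreePrimePowers) and reads: (1/x, 1/y, 1/z) is not a
simultaneous near-zero of the fixed period form beyond the trivial exponent. Heuristic for
non-triple data: a violation needs v ≥ 2 at a prime q₃ with q₁q₂ < q₃^(1−ε'), expected count Σ_q
q^(−1−ε') < ∞ (typical valuation of the form is 0: D_p at special units ≡ Teichmüller values ≡
p-adic L-values, generically units) — absorbed by C. [deps: DilogBilinearity] [difficulty:
open-problem] -/
@[route_item "route-ABC-DilogDepthLaw"]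
def ThreePrimeDepthBound : Prop :=
  ∀ ℓ : ((p : ℕ) → [Fact p.Prime] → ℕ → ℕ → ℚ_[p]), (∀ (p : ℕ) [Fact p.Prime], (∀ q q' : ℕ, ℓ p q q' = -ℓ p q' q) ∧ ∀ x : ℚ, x ≠ 0 → 1 ≤ padicValRat p x → (∑' n : ℕ, ((x : ℚ_[p]) ^ (n + 1)) / (((n : ℚ_[p]) + 1) ^ 2)) + (1 / 2 : ℚ_[p]) * Literature.NumberTheory.EllipticCurves.padicLog p (x : ℚ_[p]) * Literature.NumberTheory.EllipticCurves.padicLog p (1 - (x : ℚ_[p])) = ∑ q ∈ (x.num.natAbs * x.den * (1 - x).num.natAbs).primeFactors, ∑ q' ∈ (x.num.natAbs * x.den * (1 - x).num.natAbs).primeFactors, ((padicValRat q x : ℤ) : ℚ_[p]) * ((padicValRat q' (1 - x) : ℤ) : ℚ_[p]) * ℓ p q q') → ∀ ε : ℝ, 0 < ε → ∃ C : ℝ, 0 < C ∧ ∀ (q₁ q₂ q₃ : ℕ) [Fact q₃.Prime], q₁.Prime → q₂.Prime → q₁ ≠ q₂ → q₁ ≠ q₃ → q₂ ≠ q₃ →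 ∀ x y z : ℕ, 0 < x → 0 < y → 0 < z → (((q₃ ^ min z (Padic.valuation (((x * y : ℕ) : ℚ_[q₃]) * ℓ q₃ q₁ q₂ - ((x * z : ℕ) : ℚ_[q₃]) * ℓ q₃ q₁ q₃ + ((y * z : ℕ) : ℚ_[q₃]) * ℓ q₃ q₂ q₃)).toNat) : ℕ) : ℝ) ≤ C * ((q₁ * q₂ * q₃ : ℕ) : ℝ) ^ (1 + ε) * ((max (q₁ ^ x) (max (q₂ ^ y) (q₃ ^ z)) : ℕ) : ℝ) ^ ε

/-- item stmt-ABC-3605 · crux · rank 4 · closed · moot by None · by planner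
why it might fail: Suspect false: non-triple (2^i,3^j,P²) has B_P ≡ 2·log_P(3^j/2^i) mod P² (checked P≤71), so depth = P² = c at Wieferich-type coincidences i·F₂≡j·F₃ mod P (e.g. depth(8,3,49)=49, depth(2,3,23²)=23²); 220 primes ≤2·10⁵; infinitely many kill every ε<1/3.
sources: Silverman1988, CrandallDilcherPomerance1997, DancohenWewers2014, Philippon1999, StewartYu2001, EvertseGyory2015
[crux] BDB(ε), general support (card S3, corrected): for every admissible system ℓ and every ε > 0
there is C > 0 such that for all pairwise coprime positive a, b, c: Π_(p|c) p^min(v_p(c),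
v_p(B_p(a,b,c))) ≤ C^(ω(abc)+1)·rad(abc)^(1+ε)·max(a,b,c)^ε, with B_p(a,b,c) = Σ_(q,q' | abc) (v_q a
− v_q c)(v_(q') b − v_(q') c)·ℓ_p(q,q') ∈ ℚ_p (Lean: valuation of 0 is 0, and the min caps
accidental over-depth, so only 'as deep as c itself' counts). Restricted to a + b = c it is
EQUIVALENT to ABC given DilogBilinearity + DepthLaw; for general data it is the statement that one
integer antisymmetric rank-2 matrix e∧f is not p-adically orthogonal to the universal period
matrices M_p at the primes of c beyond what rad(abc)^(1+ε)·height^ε pays for. Corrections w.r.t. the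
card: depth on the c-support only (v1's total excess is false on (1, 9ⁿ−1, 9ⁿ)); the size term
max(a,b,c)^ε is NECESSARY (data (2^T, 3^U, 5): depth ≍ 2 log T unbounded at fixed radical); constant
C^(ω+1) = the card's C_ε·|S| in multiplicative form, absorbed in the assembly by 2^ω(n) ≤ d(n) ≪
n^δ. [deps: DilogBilinearity] [difficulty: open-problem] -/
@[route_item "route-ABC-DilogDepthLaw"]
def BilinearDepthBound : Prop :=
  ∀ ℓ : ((p : ℕ) → [Fact p.Prime] → ℕ → ℕ → ℚ_[p]), (∀ (p : ℕ) [Fact p.Prime], (∀ q q' : ℕ, ℓ p q q' = -ℓ p q' q) ∧ ∀ x : ℚ, x ≠ 0 → 1 ≤ padicValRat p x → (∑' n : ℕ, ((x : ℚ_[p]) ^ (n + 1)) / (((n : ℚ_[p]) + 1) ^ 2)) + (1 / 2 : ℚ_[p]) * Literature.NumberTheory.EllipticCurves.padicLog p (x : ℚ_[p]) * Literature.NumberTheory.EllipticCurves.padicLog p (1 - (x : ℚ_[p])) = ∑ q ∈ (x.num.natAbs * x.den * (1 - x).num.natAbs).primeFactors, ∑ q' ∈ (x.num.natAbs * x.den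 * (1 - x).num.natAbs).primeFactors, ((padicValRat q x : ℤ) : ℚ_[p]) * ((padicValRat q' (1 - x) : ℤ) : ℚ_[p]) * ℓ p q q') → ∀ ε : ℝ, 0 < ε → ∃ C : ℝ, 0 < C ∧ ∀ a b c : ℕ, 0 < a → 0 < b → 0 < c → Nat.Coprime a b → Nat.Coprime b c → Nat.Coprime a c → (((∏ p ∈ c.primeFactors, (if hp : p.Prime then (haveI : Fact p.Prime := ⟨hp⟩; p ^ min (c.factorization p) (Padic.valuation (∑ q ∈ (a * b * c).primeFactors, ∑ q' ∈ (a * b * c).primeFactors, (((a.factorization q : ℤ) - (c.factorization q : ℤ) : ℤ) : ℚ_[p]) * (((b.factorization q' : ℤ) - (c.factorization q' : ℤ) : ℤ) : ℚ_[p]) * ℓ p q q')).toNat) else 1)) : ℕ) : ℝ) ≤ C ^ ((a * b * c).primeFactors.card + 1) * ((Literature.NumberTheory.DiophantineGeometry.rad a b c : ℕ) : ℝ) ^ (1 + ε) * ((max a (max b c) : ℕ) : ℝ) ^ ε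

/-- item stmt-ABC-3603 · support · rank 2 · closed · moot by None · by planner
why it might fail: Coleman's 5-term relation must hold for his D with ONE fixed branch across all residue discs incl. |x|_p ≠ 1 (we use x with p | num x); if Col82 §VI proves it only on units / up to a constant, additivity on P(ℚ) at p ∈ S breaks — exactly the bad-prime extension DCW avoid (they take p > max S).
sources: Coleman1982, Wojtkowiak1991, Suslin1991, LeeSzczarba1976, Milnor1972, BesserDejeu2003
[crux] CONSTRUCTION / named fact (first crux on purpose: the route's object). For every prime p
there is an antisymmetric ℓ_p : ℕ → ℕ → ℚ_p with D_p(x) = Σ_{q,q' ∈ primeFactors(num x · den x ·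
num(1−x))} v_q(x)·v_{q'}(1−x)·ℓ_p(q,q') for every rational x ≠ 0 with v_p(x) ≥ 1, where D_p(x) =
Σ_{n≥1} xⁿ/n² + ½ log_p x · log_p(1−x) (Iwasawa log_p = Literature padicLog). Paper proof:
Coleman1982 §VI (D = Li₂ + ½ log·log(1−·) satisfies inversion Prop 6.4, reflection, and the 5-term
relation on ℂ_p∖{0,1}; BesserDejeu2003 p.4) ⇒ D_p is additive on the pre-Bloch group P(ℚ);
Suslin1991 Thm 5.2 + LeeSzczarba1976 (K₃(ℤ)=ℤ/48 ⇒ B(ℚ)⊗ℚ = 0) + Tate (K₂(ℚ) torsion, Milnor1972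
§11) ⇒ δ⊗ℚ is an isomorphism ⇒ L_p := D_p∘(δ⊗ℚ)⁻¹, ℓ_p(q,q') := L_p(q∧q'); at p-small x the series
IS Coleman's D_p. Card items S1. Expected to enter Literature as a cited fact (cite item filed) and
then be discharged as `(h : Fact) → DilogBilinearity`; a Lean proof from scratch needs Coleman
integration (far). [difficulty: L] -/
@[route_item "route-ABC-DilogDepthLaw"]
def DilogBilinearity : Prop :=
  ∀ (p : ℕ) [Fact p.Prime], ∃ ℓ : ℕ → ℕ → ℚ_[p], (∀ q q' : ℕ, ℓ q q' = -ℓ q' q) ∧ ∀ x : ℚ, x ≠ 0 → 1 ≤ padicValRat p x → (∑' n : ℕ, ((x : ℚ_[p]) ^ (n + 1)) / (((n : ℚ_[p]) + 1) ^ 2)) + (1 / 2 : ℚ_[p]) * Literature.NumberTheory.EllipticCurves.padicLog p (x : ℚ_[p]) * Literature.NumberTheory.EllipticCurves.padicLog p (1 - (x : ℚ_[p])) = ∑ q ∈ (x.num.natAbs * x.den * (1 - x).num.natAbs).primeFactors, ∑ q' ∈ (x.num.natAbs * x.den * (1 - x).num.natAbs).primeFactors, ((padicValRat q x : ℤ)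 : ℚ_[p]) * ((padicValRat q' (1 - x) : ℤ) : ℚ_[p]) * ℓ q q'

/-- item stmt-ABC-3606 · support · rank 9 · closed · moot by None · by planner
sources: Coleman1982, Iwasawa1972PadicL
[support] the depth law (card S1; provable now, elementary ultrametric estimates): for p prime and
rational x ≠ 0 with v = v_p(x) ≥ 1, and (p ≠ 2 or v ≥ 3): the valuation of D_p(x) = Σ xⁿ/n² + ½
log_p x log_p(1−x) is exactly v. Proof sketch: the n = 1 term is x; for n ≥ 2, n·v − 2v_p(n) ≥ v+1
except (p,v,n) = (3,1,3) where x + x³/9 = x(1 + (x/3)²) and (x/3)² ≡ 1 (mod 3) since −1 is a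
non-residue, so the valuation is still v; log_p of the unit part has valuation ≥ 1 (≥ 2 at p = 2)
and log_p(1−x) = −Σ xⁿ/n has valuation v (p odd; v for p = 2, v ≥ 2), so the log term has valuation
≥ v+1. At p = 2, v ∈ {1,2} only ≥ holds (not claimed). Uses the PROVED tree facts
hasSum_padicLog_holds, padicLog_mul_holds, padicLog_natCast_self_holds. [difficulty: provable-now] -/
@[route_item "route-ABC-DilogDepthLaw"]
def DepthLaw : Prop :=
  ∀ (p : ℕ) [Fact p.Prime] (x : ℚ), x ≠ 0 → 1 ≤ padicValRat p x → (p ≠ 2 ∨ 3 ≤ padicValRat p x) → ((∑' n : ℕ, ((x : ℚ_[p]) ^ (n + 1)) / (((n : ℚ_[p]) + 1) ^ 2)) + (1 / 2 : ℚ_[p]) * Literature.NumberTheory.EllipticCurves.padicLog p (x : ℚ_[p]) * Literature.NumberTheory.EllipticCurves.padicLog p (1 - (x : ℚ_[p]))).valuation = padicValRat p x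

/-- item stmt-ABC-3607 · support · rank 9 · closed · moot by None · by planner
sources: Milnor1972, DancohenWewers2014, Suslin1991
[support] uniqueness of admissible systems (makes '∀ admissible ℓ' in the two BDB cruxes mean
'Coleman's canonical ℓ'): for every prime p and primes q ≠ q', the elementary antisymmetric matrix
E_(qq') − E_(q'q) is a ℚ-combination of the symbols σ(a,b,c) = (v(a)−v(c)) ∧ (v(b)−v(c)) of abc
triples with p | abc. (p-small rationals x are exactly members-ratios of triples with p dividing a
member; their symbols are ±σ.) Equivalently: the p-divisible part of P(ℚ)⊗ℚ is everything. Expected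
true with enormous over-determination (for S = primes ≤ X the number of X-smooth triples is
super-exponential in π(X) while dim Λ² = π(X)²/2); finite exact check per (S, p) by rank
(kit/calib.gp prints it for S = {2,3,5}, p = 3, 5); a proof wants a p-adapted variant of Tate's
largest-prime descent (Milnor1972 §11; DancohenWewers2014 §11 is the p-free version). [difficulty:
M] -/
@[route_item "route-ABC-DilogDepthLaw"]
def SymbolSpan : Prop :=
  ∀ p q q' : ℕ, p.Prime → q.Prime → q'.Prime → q ≠ q' → ∃ (T : Finset (ℕ × ℕ × ℕ)) (w : ℕ × ℕ × ℕ → ℚ), (∀ t ∈ T, Literature.NumberTheory.DiophantineGeometry.IsABCTriple t.1 t.2.1 t.2.2 ∧ p ∣ t.1 * t.2.1 * t.2.2) ∧ ∀ r r' : ℕ, (∑ t ∈ T, w t * ((((t.1.factorization r : ℤ) - (t.2.2.factorization r : ℤ)) * ((t.2.1.factorization r' : ℤ) - (t.2.2.factorization r' : ℤ)) - ((t.1.factorization r' : ℤ) - (t.2.2.factorization r' : ℤ)) * ((t.2.1.factorization r : ℤ) - (t.2.2.factorization r : ℤ)) : ℤ) : ℚ)) = (if r = q ∧ r' = q' then (1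 : ℚ) else 0) - (if r = q' ∧ r' = q then (1 : ℚ) else 0)

/-- item stmt-ABC-3608 · support · rank 9 · closed · moot by None · by planner
sources: DancohenWewers2014, Coleman1982
[support] milestone glue (card 'rank-0 milestone'): DilogBilinearity → ThreePrimeDepthBound → abc
for triples of three prime powers (a, b, c all prime powers): ∀ ε > 0 ∃ C > 0, c < C·rad(abc)^(1+ε).
Proof: instantiate ℓ from DilogBilinearity (choice over p), apply the three-prime bound at
(q₁,q₂,q₃; x,y,z) read off a = q₁^x, b = q₂^y, c = q₃^z, and use DepthLaw at x = c/a (q₃ odd, or q₃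
= 2 with z ≥ 3; z ≤ 2 at q₃ = 2 is c ≤ 4) to get min(z, v) = z. [difficulty: provable-now] -/
@[route_item "route-ABC-DilogDepthLaw"]
def ThreePrimePowers : Prop :=
  DilogBilinearity → ThreePrimeDepthBound → ∀ ε : ℝ, 0 < ε → ∃ C : ℝ, 0 < C ∧ ∀ a b c : ℕ, Literature.NumberTheory.DiophantineGeometry.IsABCTriple a b c → IsPrimePow a → IsPrimePow b → IsPrimePow c → (c : ℝ) < C * ((Literature.NumberTheory.DiophantineGeometry.rad a b c : ℕ) : ℝ) ^ (1 + ε)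

/-- item stmt-ABC-3609 · assembly · rank 1 · closed · moot by None · by planner
sources: DancohenWewers2014, BombieriGubler2006
[assembly] DilogBilinearity → BilinearDepthBound → ABC (uses support DepthLaw and the ω-absorption
lemma inside the proof). -/
@[route_item "route-ABC-DilogDepthLaw"]
def Assembly : Prop :=
  DilogBilinearity → BilinearDepthBound → ABC

end Summit.ABC.ABC.Theses.DilogDepthLaw
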